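import Summits.RiemannHypothesis.RiemannHypothesis.Theorems.JensenLogBandArcRegime
import HarnessLib

/-!
# The regime of the TOP-SHELL hypotheses (BAND line, top-shell reshape)

RH ladder column JENSEN, rung J-P(P3) «log band», BAND crux `XiDerivBandRealAllRates` of route
«JensenLogBand», line «band-one-window» (u-arc, top-shell reshape), lead rh-jensen-prover g8.
RH-FREE real analysis. WHAT THIS IS NOT: nothing here bears on zeros of `ζ` or the truth of RH.

After the reduction «BAND ⇐ TOP SHELL» (`LogBand.BandOfShell.allReal_below_exp_of_shellReal`) the
u-arc dominance is needed only at rates `7 ≤ c < 8` and only in the top shell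
`e^{c(k−1)}/4 ≤ ‖(a+iT)²‖ < e^{ck}`, `0 < a ≤ ½`. `shell_regime` collects what this says about the height
and the radius, for `k ≥ k₁(c, ℓ₀)`:

  `T ≥ 100`, `e^{3k} ≤ T`, `T < e^{ck/2}`, `ℓ₀ ≤ ℓ_T`, `c(k−1)/2 − 3 ≤ ℓ_T`, `ℓ_T < ck/2`,
  `½ ≤ h`, `4/c < h`, `h ≤ 3/5`, `h ≤ (7/20)T`      (`ℓ_T = log(T/2π)`, `h = h(k,T) = 2(k+1)/ℓ_T`),

i.e. the single-limit regime `T → ∞`, `h → 4/c ∈ (½, 4/7]` in which all of g7's infrastructure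
(`T ≥ 100`, `ℓ_T ≥ ℓ₀`, `½ ≤ h ≤ 7T/20`, `h ≤ 20`) applies and `h/T ≤ e^{−3k}`.
-/

noncomputable section

-- single-problem summit: `Summit.RiemannHypothesis.RiemannHypothesis.…` is the tree convention
set_option linter.dupNamespace false

open Complex Real

namespace Summit.RiemannHypothesis.RiemannHypothesis.Theorems.JensenPolynomials.LogBandArc

/-- `e² > 5` and `log(2π√5) ≤ 3` type numerics: `2π·√5 ≤ e³`. [folklore] -/
theorem two_pi_sqrt_five_le_exp_three : 2 * Real.pi * Real.sqrt 5 ≤ Real.exp 3 := by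
  have hpi : Real.pi < 3.1416 := Real.pi_lt_d4
  have hs : Real.sqrt 5 < 9 / 4 := by
    rw [Real.sqrt_lt' (by norm_num)]; norm_num
  have he : (20 : ℝ) < Real.exp 3 := by
    have h1 : (2.7182818283 : ℝ) < Real.exp 1 := Real.exp_one_gt_d9
    have h3 : Real.exp 3 = Real.exp 1 ^ 3 := by rw [← Real.exp_nat_mul]; norm_num
    rw [h3]
    have h0 : (0 : ℝ) ≤ 2.7182818283 := by norm_num
    have := pow_le_pow_left₀ h0 h1.le 3
    nlinarith
  nlinarith [Real.pi_pos, Real.sqrt_nonneg 5]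

/-- **The regime of the top-shell hypotheses.** See the module docstring. [folklore] -/
theorem shell_regime (ℓ₀ : ℝ) {c : ℝ} (hc7 : 7 ≤ c) (hc8 : c < 8) :
    ∃ k₁ : ℕ, ∀ k : ℕ, k₁ ≤ k → ∀ a T : ℝ, 0 < a → a ≤ 1 / 2 → 0 < T →
      Real.exp (c * ((k : ℝ) - 1)) / 4 ≤ ‖((a : ℂ) + (T : ℂ) * I) ^ 2‖ →
      ‖((a : ℂ) + (T : ℂ) * I) ^ 2‖ < Real.exp (c * (k : ℝ)) →
      100 ≤ T ∧ Real.exp (3 * (k : ℝ)) ≤ T ∧ T < Real.exp (c * (k : ℝ) / 2) ∧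
      ℓ₀ ≤ ell T ∧ c * ((k : ℝ) - 1) / 2 - 3 ≤ ell T ∧ ell T < c * (k : ℝ) / 2 ∧
      1 / 2 ≤ bandRadius k T ∧ 4 / c < bandRadius k T ∧ bandRadius k T ≤ 3 / 5 ∧
      bandRadius k T ≤ 7 / 20 * T := by
  obtain ⟨N, hN⟩ := exists_nat_ge ((ℓ₀ + 2) / 3)
  refine ⟨max 60 N, fun k hk a T ha ha2 hT hlo hhi => ?_⟩
  have hk60 : 60 ≤ k := le_trans (le_max_left _ _) hk
  have hkN : N ≤ k := le_trans (le_max_right _ _) hk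
  have hk' : (60 : ℝ) ≤ k := by exact_mod_cast hk60
  have hkN' : (N : ℝ) ≤ k := by exact_mod_cast hkN
  have hc0 : 0 < c := by linarith
  rw [norm_sq_ofReal_add_mul_I] at hlo hhi
  have ha4 : a ^ 2 ≤ 1 / 4 := by nlinarith
  -- the two exponentials
  set E : ℝ := Real.exp (c * ((k : ℝ) - 1)) with hE
  have hE0 : 0 < E := Real.exp_pos _
  -- `E ≥ e^{7·59}` is astronomically large; we only use `E ≥ e^{6k} · 5` and `E ≥ 5`.
  have hE5 : 5 ≤ E := by
    have h1 : (5 : ℝ) ≤ Real.exp 3 := by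
      have := two_pi_sqrt_five_le_exp_three
      have h2 : (1 : ℝ) ≤ Real.sqrt 5 := by
        rw [show (1 : ℝ) = Real.sqrt 1 by simp]; exact Real.sqrt_le_sqrt (by norm_num)
      nlinarith [Real.pi_gt_three]
    refine h1.trans (Real.exp_le_exp.2 ?_)
    nlinarith
  -- `T² ≥ E/4 − 1/4 ≥ E/5`
  have hT2lo : E / 5 ≤ T ^ 2 := by linarith
  have hT2hi : T ^ 2 < Real.exp (c * (k : ℝ)) := by nlinarith
  -- (a) `T ≥ e^{3k}`: `e^{6k} ≤ E/5` since `E = e^{6k} e^{(c-6)k - c} ≥ e^{6k} e^{k - 8} ≥ e^{6k}·e^{52}`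
  have h3k : Real.exp (3 * (k : ℝ)) ≤ T := by
    have h1 : Real.exp (3 * (k : ℝ)) ^ 2 ≤ T ^ 2 := by
      rw [← Real.exp_nat_mul]
      push_cast
      have h2 : Real.exp (2 * (3 * (k : ℝ))) * 5 ≤ E := by
        have h52 : (5 : ℝ) ≤ Real.exp ((k : ℝ) - 8) :=
          le_trans (by linarith : (5 : ℝ) ≤ (k : ℝ) - 8 + 1) (Real.add_one_le_exp _)
        have : Real.exp (2 * (3 * (k : ℝ))) * Real.exp ((k : ℝ) - 8) ≤ E := by
          rw [← Real.exp_add, hE]; exact Real.exp_le_exp.2 (by nlinarith)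
        nlinarith [Real.exp_pos (2 * (3 * (k : ℝ)))]
      linarith
    exact (pow_le_pow_iff_left₀ (Real.exp_pos _).le hT.le two_ne_zero).1 h1
  -- (b) `T ≥ 100`
  have hT100 : 100 ≤ T := by
    have h1 : (100 : ℝ) ≤ Real.exp (3 * (k : ℝ)) := by
      have h2 : (100 : ℝ) ≤ 3 * (k : ℝ) + 1 := by linarith
      exact h2.trans (by linarith [Real.add_one_le_exp (3 * (k : ℝ))])
    exact h1.trans h3k
  -- (c) `T < e^{ck/2}`
  have hThi : T < Real.exp (c * (k : ℝ) / 2) := by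
    have h1 : T ^ 2 < Real.exp (c * (k : ℝ) / 2) ^ 2 := by
      rw [← Real.exp_nat_mul]; push_cast
      rwa [show 2 * (c * (k : ℝ) / 2) = c * (k : ℝ) by ring]
    exact (pow_lt_pow_iff_left₀ hT.le (Real.exp_pos _).le two_ne_zero).1 h1
  -- (d) `ℓ_T < ck/2` (`ℓ_T = log T − log 2π ≤ log T`)
  have hpi2 : (1 : ℝ) ≤ 2 * Real.pi := by linarith [Real.pi_gt_three]
  have hell_hi : ell T < c * (k : ℝ) / 2 := by
    have h1 : Real.log T < c * (k : ℝ) / 2 := by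
      rw [Real.log_lt_iff_lt_exp hT]; exact hThi
    have h2 : ell T ≤ Real.log T := by
      rw [ell, Real.log_div hT.ne' (by positivity)]
      linarith [log_two_pi_bounds.1]
    linarith
  -- (e) `ℓ_T ≥ c(k−1)/2 − 3`: `T ≥ √(E/5)` so `T/2π ≥ e^{c(k−1)/2}/(2π√5) ≥ e^{c(k−1)/2 − 3}`
  have hell_lo : c * ((k : ℝ) - 1) / 2 - 3 ≤ ell T := by
    have hsq5 : 0 < Real.sqrt 5 := Real.sqrt_pos.2 (by norm_num)
    have hs5 : Real.sqrt 5 ^ 2 = 5 := Real.sq_sqrt (by norm_num)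
    -- `e^{c(k-1)/2} ≤ √5 · T`
    have h1 : Real.exp (c * ((k : ℝ) - 1) / 2) ≤ Real.sqrt 5 * T := by
      have h2 : Real.exp (c * ((k : ℝ) - 1) / 2) ^ 2 ≤ (Real.sqrt 5 * T) ^ 2 := by
        rw [← Real.exp_nat_mul, mul_pow, hs5]; push_cast
        rw [show 2 * (c * ((k : ℝ) - 1) / 2) = c * ((k : ℝ) - 1) by ring, ← hE]
        linarith
      exact (pow_le_pow_iff_left₀ (Real.exp_pos _).le (by positivity) two_ne_zero).1 h2
    -- `e^{c(k-1)/2 - 3} · 2π ≤ e^{c(k-1)/2} / √5 ≤ T`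
    rw [ell, Real.le_log_iff_exp_le (by positivity), le_div_iff₀ (by positivity)]
    have h3 := two_pi_sqrt_five_le_exp_three
    have hA0 : 0 < Real.exp (c * ((k : ℝ) - 1) / 2) := Real.exp_pos _
    calc Real.exp (c * ((k : ℝ) - 1) / 2 - 3) * (2 * Real.pi)
        = Real.exp (c * ((k : ℝ) - 1) / 2) * (2 * Real.pi) / Real.exp 3 := by
          rw [Real.exp_sub]; ring
      _ ≤ Real.exp (c * ((k : ℝ) - 1) / 2) * (2 * Real.pi) / (2 * Real.pi * Real.sqrt 5) :=
          div_le_div_of_nonneg_left (by positivity) (by positivity) h3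
      _ = Real.exp (c * ((k : ℝ) - 1) / 2) / Real.sqrt 5 := by
          field_simp
      _ ≤ T := by rw [div_le_iff₀ hsq5]; linarith
  -- (f) `ℓ_T ≥ ℓ₀` (from `T ≥ e^{3k}`: `ℓ_T ≥ 3k − 2`)
  have hell_ℓ₀ : ℓ₀ ≤ ell T := by
    have h1 : 3 * (k : ℝ) - 2 ≤ ell T := by
      rw [ell, Real.log_div hT.ne' (by positivity)]
      have : 3 * (k : ℝ) ≤ Real.log T := by
        rw [Real.le_log_iff_exp_le hT]; exact h3k
      linarith [log_two_pi_bounds.2]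
    have h2 : (ℓ₀ + 2) / 3 ≤ k := hN.trans hkN'
    linarith
  have hell_pos : 0 < ell T := by
    have : (0 : ℝ) < c * ((k : ℝ) - 1) / 2 - 3 := by nlinarith
    linarith
  -- (g) radius bounds: `h = 2(k+1)/ℓ_T`
  have hh_gt : 4 / c < bandRadius k T := by
    rw [bandRadius, lt_div_iff₀ hell_pos, div_mul_eq_mul_div, div_lt_iff₀ hc0]
    nlinarith
  have hh_half : 1 / 2 ≤ bandRadius k T := by
    have : (1 / 2 : ℝ) ≤ 4 / c := by rw [le_div_iff₀ hc0]; linarith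
    exact this.trans hh_gt.le
  have hh_le : bandRadius k T ≤ 3 / 5 := by
    rw [bandRadius, div_le_iff₀ hell_pos]
    -- `2(k+1) ≤ (3/5)(c(k−1)/2 − 3)` since `c ≥ 7`, `k ≥ 60`
    nlinarith
  refine ⟨hT100, h3k, hThi, hell_ℓ₀, hell_lo, hell_hi, hh_half, hh_gt, hh_le, ?_⟩
  linarith

end Summit.RiemannHypothesis.RiemannHypothesis.Theorems.JensenPolynomials.LogBandArc

end
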